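import Summits.CriticalPhenomena.PercolationContinuityZ3.Theorems.Transplant.SkelNegBParamsRootArithP
import HarnessLib

/-!
# N1 params, chain of record `NegB`, part RootArithY3: the x-PREFIX prism readings with the TRANSVERSE-type target `±(5r₀ − 2)` (`prefix_pos'/prefix_neg'`,
# `N ≤ 3`, no centring) — in the y-family of p3's `rootOblTWAt_negBT_y` the prefix's along axis `0` is the cell's `oth` axis, so `hPf₃` asks for `±(5r₀ − 2)`
# (part RootArithY2's `prefix_pos/neg` give the along-type target `[−5r₀+1, 25r₀−1]`)

builds on p205010 (kernel theorem, internal audit signed; external expert review pending) — nothing in this file uses p205010; NOTHING is claimed about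
the node `SamePDropOfSkeletonNeg₁` (OPEN).  Pure arithmetic; no definitions.
Lane `prim-bschramm-*`, seat `prim-bschramm-stmt` (gen 14); helper file (`--supports stmt-CriticalPhenomena-4575 --as helper`); ledger HOME/prim-bschramm-stmt/NEG-PARAMS.md v0.13.
[cite: KozmaNitzan2024, §4 p. 28 ((32) at the root)] [cite: MartineauTassion2017, §4.3 Lemma 4.2]
-/

namespace Summit.CriticalPhenomena.PercolationContinuityZ3.Theorems.Transplant

namespace PlanarSkeletonNeg

namespace NegB

namespace RootArith

/-- **x-PREFIX PRISM ALONG, `σ = 1`, short run** (`N ≤ 3`, no centring), TRANSVERSE-TYPE TARGET: inside `±(5r₀ − 2)` (the y-family's `hPf₃`). [cite: KozmaNitzan2024, §4 p. 28] -/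
theorem prefix_pos' {u m n su v ℓ W RA Lb q N Λ : ℤ} (hu : 1 ≤ u) (hn : 1 ≤ n) (hm : n * (ℓ - 1) < m) (hsu : n ≤ su) (hsu' : su ≤ 11 * n)
    (hv : |v| ≤ n) (hW : su * W ≤ n * ℓ + su) (hW0 : 0 ≤ W) (hLb : su * Lb ≤ 3 * (n * ℓ) + su) (hLb0 : 0 ≤ Lb)
    (hRA : 0 ≤ RA) (hRAn : 2000 * (RA + 2) ≤ n) (hRAℓ : 22000 * (RA + 2) ≤ ℓ)
    (hq : 0 ≤ q) (hq' : 4 * q ≤ n) (hN : 0 ≤ N) (hN3 : N ≤ 3) (hΛ : |Λ| ≤ 3 * m) :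
    -(5 * (40 * u) - 2) ≤ (800 * u * (800 * Λ) + 640000 * m / 2) / (640000 * m) +
        (800 * u * (800 * (m * (min (1 * (-q - (N + 1) * RA - n)) (1 * (N * n + q + (N + 1) * RA + n))) -
          max (v * (su * (min (1 * (-(W + (N + 1) * RA + Lb))) (1 * (W + (N + 1) * RA + Lb)) - 1))) (v * (su * (max (1 * (-(W + (N + 1) * RA + Lb))) (1 * (W + (N + 1) * RA + Lb))) + su - 1))) / n)) /
          (640000 * m) ∧
      (800 * u * (800 * Λ) + 640000 * m / 2) / (640000 * m) +
        (800 * u * (800 * (m * (max (1 * (-q - (N + 1) * RA - n)) (1 * (N * n + q + (N + 1) * RA + n))) -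
          min (v * (su * (min (1 * (-(W + (N + 1) * RA + Lb))) (1 * (W + (N + 1) * RA + Lb)) - 1))) (v * (su * (max (1 * (-(W + (N + 1) * RA + Lb))) (1 * (W + (N + 1) * RA + Lb))) + su - 1))) / n)) /
          (640000 * m) + 1 ≤ 5 * (40 * u) - 2 := by
  have hN' : N + 1 ≤ 1000 := by linarith
  -- lower bound: `prism_pos` uses the centring only for the upper bound; we redo both with `N ≤ 3`
  have hm0 : 0 < m := by nlinarith
  have hn0 : 0 < n := by linarith
  have hu0 : 0 ≤ u := by linarith
  have hNR : 0 ≤ (N + 1) * RA := by positivity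
  have hqr : 4 * (q + (N + 1) * RA) ≤ 3 * n := by nlinarith
  set L := W + (N + 1) * RA + Lb with hLdef
  have hL0 : 0 ≤ L := by rw [hLdef]; positivity
  simp only [one_mul]
  rw [min_eq_left (by nlinarith : -q - (N + 1) * RA - n ≤ N * n + q + (N + 1) * RA + n),
    max_eq_right (by nlinarith : -q - (N + 1) * RA - n ≤ N * n + q + (N + 1) * RA + n),
    min_eq_left (by linarith : -L ≤ L), max_eq_right (by linarith : -L ≤ L)]
  obtain ⟨-, hBx, hBn⟩ := prism_B (v := v) hn hm hsu hsu' hv hW hW0 hLb hLb0 hRA hRAℓ hN hN'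
  set Bmax := max (v * (su * (-L - 1))) (v * (su * L + su - 1))
  set Bmin := min (v * (su * (-L - 1))) (v * (su * L + su - 1))
  obtain ⟨f1, f2⟩ := coarse_bounds (u := u) (Λ := Λ) hm0
  set F := (800 * u * (800 * Λ) + 640000 * m / 2) / (640000 * m)
  obtain ⟨hΛ1, hΛ2⟩ := abs_le.1 hΛ
  have hFlo : -3 * u ≤ F := by
    by_contra hc; push Not at hc
    have h1 : 2 * m * F ≤ 2 * m * (-3 * u - 1) := mul_le_mul_of_nonneg_left (by linarith) (by positivity)
    nlinarith
  have hFhi : F ≤ 3 * u := by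
    by_contra hc; push Not at hc
    have h1 : 2 * m * (3 * u + 1) ≤ 2 * m * F := mul_le_mul_of_nonneg_left (by linarith) (by positivity)
    nlinarith
  constructor
  · obtain ⟨-, g2⟩ := incr_bounds (u := u) (m := m) (n := n) (a := -q - (N + 1) * RA - n) (B := Bmax) hu0 hm0 hn0
    set G := 800 * u * (800 * (m * (-q - (N + 1) * RA - n) - Bmax) / n) / (640000 * m)
    have e1 : u * (4 * (m * (-q - (N + 1) * RA - n))) ≥ u * (-(7 * m * n)) := by
      refine mul_le_mul_of_nonneg_left ?_ hu0
      have := mul_le_mul_of_nonneg_left hqr hm0.le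
      linarith
    have e2 : 2 * (u * Bmax) ≤ 9 * u * m * n := by
      have h1 : u * Bmax ≤ u * |Bmax| := mul_le_mul_of_nonneg_left (le_abs_self _) hu0
      have h2 := mul_le_mul_of_nonneg_left hBx hu0
      linarith
    have key : 800 * m * n * (G + 7 * u + 1) ≥ 600 * u * m * n - u * n := by linarith
    have hX : 0 ≤ G + 7 * u + 1 := by
      by_contra hc; push Not at hc
      have h1 : 800 * m * n * (G + 7 * u + 1) ≤ 800 * m * n * (-1) := mul_le_mul_of_nonneg_left (by linarith) (by positivity)
      have h2 : 0 ≤ u * n * (600 * m - 1) := mul_nonneg (mul_nonneg hu0 hn0.le) (by linarith)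
      have hmn : 0 < m * n := mul_pos hm0 hn0
      nlinarith
    linarith
  · obtain ⟨g1, -⟩ := incr_bounds (u := u) (m := m) (n := n) (a := N * n + q + (N + 1) * RA + n) (B := Bmin) hu0 hm0 hn0
    set G := 800 * u * (800 * (m * (N * n + q + (N + 1) * RA + n) - Bmin) / n) / (640000 * m)
    have e1 : u * (4 * (m * (N * n + q + (N + 1) * RA + n))) ≤ u * (4 * m * n * N + 7 * m * n) := by
      refine mul_le_mul_of_nonneg_left ?_ hu0
      have := mul_le_mul_of_nonneg_left hqr hm0.le
      linarith
    have e2 : 2 * (u * (-Bmin)) ≤ 9 * u * m * n := by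
      have h1 : u * (-Bmin) ≤ u * |Bmin| := mul_le_mul_of_nonneg_left (neg_le_abs _) hu0
      have h2 := mul_le_mul_of_nonneg_left hBn hu0
      linarith
    have key : 4 * (m * n * G) ≤ 4 * u * m * n * N + 25 * u * m * n := by linarith
    have hX : G ≤ u * N + 7 * u - 1 := by
      by_contra hc; push Not at hc
      have h1 : 4 * (m * n) * (u * N + 7 * u) ≤ 4 * (m * n) * G := mul_le_mul_of_nonneg_left (by linarith) (by positivity)
      have h2 : 0 < u * m * n := mul_pos (mul_pos (by linarith) hm0) hn0
      nlinarith
    have hN3' : u * N ≤ u * 3 := mul_le_mul_of_nonneg_left hN3 hu0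
    linarith

/-- **x-PREFIX PRISM ALONG, `σ = −1`, TRANSVERSE-TYPE TARGET** (`N ≤ 3`). [cite: KozmaNitzan2024, §4 p. 28] -/
theorem prefix_neg' {u m n su v ℓ W RA Lb q N Λ : ℤ} (hu : 1 ≤ u) (hn : 1 ≤ n) (hm : n * (ℓ - 1) < m) (hsu : n ≤ su) (hsu' : su ≤ 11 * n)
    (hv : |v| ≤ n) (hW : su * W ≤ n * ℓ + su) (hW0 : 0 ≤ W) (hLb : su * Lb ≤ 3 * (n * ℓ) + su) (hLb0 : 0 ≤ Lb)
    (hRA : 0 ≤ RA) (hRAn : 2000 * (RA + 2) ≤ n) (hRAℓ : 22000 * (RA + 2) ≤ ℓ)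
    (hq : 0 ≤ q) (hq' : 4 * q ≤ n) (hN : 0 ≤ N) (hN3 : N ≤ 3) (hΛ : |Λ| ≤ 3 * m) :
    -(5 * (40 * u) - 2) ≤ -((800 * u * (800 * Λ) + 640000 * m / 2) / (640000 * m) +
        (800 * u * (800 * (m * (max ((-1) * (-q - (N + 1) * RA - n)) ((-1) * (N * n + q + (N + 1) * RA + n))) -
          min (v * (su * (min ((-1) * (-(W + (N + 1) * RA + Lb))) ((-1) * (W + (N + 1) * RA + Lb)) - 1))) (v * (su * (max ((-1) * (-(W + (N + 1) * RA + Lb))) ((-1) * (W + (N + 1) * RA + Lb))) + su - 1))) / n)) /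
          (640000 * m) + 1) ∧
      -((800 * u * (800 * Λ) + 640000 * m / 2) / (640000 * m) +
        (800 * u * (800 * (m * (min ((-1) * (-q - (N + 1) * RA - n)) ((-1) * (N * n + q + (N + 1) * RA + n))) -
          max (v * (su * (min ((-1) * (-(W + (N + 1) * RA + Lb))) ((-1) * (W + (N + 1) * RA + Lb)) - 1))) (v * (su * (max ((-1) * (-(W + (N + 1) * RA + Lb))) ((-1) * (W + (N + 1) * RA + Lb))) + su - 1))) / n)) /
          (640000 * m)) ≤ 5 * (40 * u) - 2 := by
  have hN' : N + 1 ≤ 1000 := by linarith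
  have hm0 : 0 < m := by nlinarith
  have hn0 : 0 < n := by linarith
  have hu0 : 0 ≤ u := by linarith
  have hNR : 0 ≤ (N + 1) * RA := by positivity
  have hqr : 4 * (q + (N + 1) * RA) ≤ 3 * n := by nlinarith
  set L := W + (N + 1) * RA + Lb with hLdef
  have hL0 : 0 ≤ L := by rw [hLdef]; positivity
  simp only [neg_mul, one_mul, neg_neg]
  rw [max_eq_left (by nlinarith : -(N * n + q + (N + 1) * RA + n) ≤ -(-q - (N + 1) * RA - n)),
    min_eq_right (by nlinarith : -(N * n + q + (N + 1) * RA + n) ≤ -(-q - (N + 1) * RA - n)),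
    min_eq_right (by linarith : -L ≤ L), max_eq_left (by linarith : -L ≤ L)]
  obtain ⟨-, hBx, hBn⟩ := prism_B (v := v) hn hm hsu hsu' hv hW hW0 hLb hLb0 hRA hRAℓ hN hN'
  set Bmax := max (v * (su * (-L - 1))) (v * (su * L + su - 1))
  set Bmin := min (v * (su * (-L - 1))) (v * (su * L + su - 1))
  obtain ⟨f1, f2⟩ := coarse_bounds (u := u) (Λ := Λ) hm0
  set F := (800 * u * (800 * Λ) + 640000 * m / 2) / (640000 * m)
  obtain ⟨hΛ1, hΛ2⟩ := abs_le.1 hΛ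
  have hFlo : -3 * u ≤ F := by
    by_contra hc; push Not at hc
    have h1 : 2 * m * F ≤ 2 * m * (-3 * u - 1) := mul_le_mul_of_nonneg_left (by linarith) (by positivity)
    nlinarith
  have hFhi : F ≤ 3 * u := by
    by_contra hc; push Not at hc
    have h1 : 2 * m * (3 * u + 1) ≤ 2 * m * F := mul_le_mul_of_nonneg_left (by linarith) (by positivity)
    nlinarith
  constructor
  · obtain ⟨g1, -⟩ := incr_bounds (u := u) (m := m) (n := n) (a := -(-q - (N + 1) * RA - n)) (B := Bmin) hu0 hm0 hn0
    set G := 800 * u * (800 * (m * -(-q - (N + 1) * RA - n) - Bmin) / n) / (640000 * m)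
    have e1 : u * (4 * (m * -(-q - (N + 1) * RA - n))) ≤ u * (7 * m * n) := by
      refine mul_le_mul_of_nonneg_left ?_ hu0
      have := mul_le_mul_of_nonneg_left hqr hm0.le
      linarith
    have e2 : 2 * (u * (-Bmin)) ≤ 9 * u * m * n := by
      have h1 : u * (-Bmin) ≤ u * |Bmin| := mul_le_mul_of_nonneg_left (neg_le_abs _) hu0
      have h2 := mul_le_mul_of_nonneg_left hBn hu0
      linarith
    have key : 4 * (m * n * G) ≤ 25 * u * m * n := by linarith
    have hX : G ≤ 7 * u - 1 := by
      by_contra hc; push Not at hc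
      have h1 : 4 * (m * n) * (7 * u) ≤ 4 * (m * n) * G := mul_le_mul_of_nonneg_left (by linarith) (by positivity)
      have h2 : 0 < u * m * n := mul_pos (mul_pos (by linarith) hm0) hn0
      nlinarith
    linarith
  · obtain ⟨-, g2⟩ := incr_bounds (u := u) (m := m) (n := n) (a := -(N * n + q + (N + 1) * RA + n)) (B := Bmax) hu0 hm0 hn0
    set G := 800 * u * (800 * (m * -(N * n + q + (N + 1) * RA + n) - Bmax) / n) / (640000 * m)
    have e1 : u * (4 * (m * -(N * n + q + (N + 1) * RA + n))) ≥ u * (-(4 * m * n * N) - 7 * m * n) := by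
      refine mul_le_mul_of_nonneg_left ?_ hu0
      have := mul_le_mul_of_nonneg_left hqr hm0.le
      linarith
    have e2 : 2 * (u * Bmax) ≤ 9 * u * m * n := by
      have h1 : u * Bmax ≤ u * |Bmax| := mul_le_mul_of_nonneg_left (le_abs_self _) hu0
      have h2 := mul_le_mul_of_nonneg_left hBx hu0
      linarith
    have key : 800 * m * n * (G + u * N + 7 * u + 1) ≥ 600 * u * m * n - u * n := by linarith
    have hX : 0 ≤ G + u * N + 7 * u + 1 := by
      by_contra hc; push Not at hc
      have h1 : 800 * m * n * (G + u * N + 7 * u + 1) ≤ 800 * m * n * (-1) := mul_le_mul_of_nonneg_left (by linarith) (by positivity)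
      have h2 : 0 ≤ u * n * (600 * m - 1) := mul_nonneg (mul_nonneg hu0 hn0.le) (by linarith)
      have hmn : 0 < m * n := mul_pos hm0 hn0
      nlinarith
    have hN3' : u * N ≤ u * 3 := mul_le_mul_of_nonneg_left hN3 hu0
    linarith

end RootArith

end NegB

end PlanarSkeletonNeg

end Summit.CriticalPhenomena.PercolationContinuityZ3.Theorems.Transplant
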